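import Summits.KontsevichZagierPeriods.KontsevichZagierPeriods.Theorems.FermatIsogenyBetaProductSectorStubTwinDupStepRight

/-!
# `BetaProductSector` (stmt-KontsevichZagierPeriods-3898), line `registered` (v3) — stub `stub_twinDupStep`,
# part 6: the right chain (box charts and branch exchange) of the twin-duplication move X9

Sixth part of the twin-duplication move X9 `B(a+b-½, b+½)·B(b, a+½-b) = 4^{a-b}·B(a+b-½, a+½-b)·B(a, 2b)`.
On the parameter triangle `Ω = {(t,m) | 0 < t < m < 1}` the left chain (part 4) ends with `L = [Ω, ℓ]`,
`ℓ = 2·pre·2m(m²-t²)`. Here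

* `TwinDupStep.right_box_chain`: the weighted RIGHT box `R = [(0,1)², 4^{a-b}x^{a+b-3/2}(1-x)^{a-b-½}y^{a-1}(1-y)^{2b-1}]`
  EXISTS (Euler's Beta integral) and is reached from `M = [Ω, r]`, `r = 2·pre·t(1+m²-2mt)`, by the two rational
  charts `κ(x,m) = (m²(1-x)/x, m)` (`Ω' → Ω`) and `ρ(x,m) = (x, m/D̃)` (`Ω' → (0,1)²`) of part 1 (rule (2) twice);
* `TwinDupStep.twin_right_chain`, the BRANCH EXCHANGE: `ℓ - r = 2·pre·c` with `c = 2m³ - tm² - t` changes sign across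
  the critical curve `c = 0` of the fibre function `m ↦ P(t,m) = 4mt/D̂`, and the ghost chart `(t,m) ↦ (t,P)`
  (part 3, `det = -4tc/D̂²`) carries `[Ω₊, 2·pre·c]` and `[Ω₋, -2·pre·c]` onto ONE representation on the common
  image of the two laps, so the ghost terms cancel: discard the null curve and split along the laps
  (rule (1a)), split the integrands (rule (1b)), exchange the branches (rule (2) twice), reassemble.

All intermediate representations are constructed (Euler–Mellin integrands; the image of a lap is semialgebraic by
the tree's Tarski–Seidenberg image theorem, the critical curve is null by the tree's polynomial zero-set lemma).
Everything is proved; no `def`, no named fact.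
-/

noncomputable section

open MeasureTheory Set
open Literature.ModelTheory.ExponentialFields (IsSemialgebraic)
open MvPolynomial (aeval X C)

namespace Summit.KontsevichZagierPeriods.FermatIsogeny.BetaProductSectorStubs

open Literature.NumberTheory.Transcendental
open Literature.NumberTheory.Transcendental.KZ

namespace TwinDupStep

/-! ## The right box and its transport onto the parameter triangle -/

/-- **The right box chain of the twin-duplication move**: the weighted right box
`R = [(0,1)², 4^{a-b}x^{a+b-3/2}(1-x)^{a-b-½}y^{a-1}(1-y)^{2b-1}]` EXISTS (Euler's Beta integral) and is
equivalent to the representation `M = [Ω, r]` pinned on the parameter triangle with the right integrand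
`r = 2·(4mt)^{a-1}(4t(m-t)(1-m²))^{2b-1}(64t)^{½-b}D̂^{-a-2b}·t(1+m²-2mt)`, WHICH EXISTS: the box is charted by
`ρ(x,m) = (x, m/D̃)` from `Ω'`, and `Ω` by `κ(x,m) = (m²(1-x)/x, m)` from `Ω'` (rule (2) twice).
[cite: KontsevichZagier2001, §1.2 rule (2)] -/
theorem right_box_chain : ∀ (a b : ℚ), 0 < b → 1 / 2 < a + b → b < a + 1 / 2 → ∃ R M : Literature.NumberTheory.Transcendental.KZ.IntegralRep 2, R.domain = {x | ∀ i, x i ∈ Set.Ioo (0:ℝ) 1} ∧ Set.EqOn R.integrand (fun z => (4:ℝ) ^ ((a:ℝ) - b) * (z 0) ^ ((a:ℝ) + b - 1 / 2 - 1) * (1 - z 0) ^ ((a:ℝ) + 1 / 2 - b - 1) * (z 1) ^ ((a:ℝ) - 1) * (1 - z 1) ^ (2 * (b:ℝ) - 1)) R.domain ∧ M.domain = {z : Fin 2 → ℝ | 0 < z 0 ∧ z 0 < z 1 ∧ z 1 < 1} ∧ Set.EqOn M.integrand (Literature.NumberTheory.Transcendental.KZ.mellinIntegrand (![4 * MvPolynomial.X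 1 * MvPolynomial.X 0, 4 * MvPolynomial.X 0 * (MvPolynomial.X 1 - MvPolynomial.X 0) * (1 - MvPolynomial.X 1 ^ 2), 64 * MvPolynomial.X 0, MvPolynomial.X 1 * (MvPolynomial.X 1 - MvPolynomial.X 0) ^ 2 + MvPolynomial.X 0 * (1 + MvPolynomial.X 1) ^ 2, MvPolynomial.X 0 * (1 + MvPolynomial.X 1 ^ 2 - 2 * MvPolynomial.X 1 * MvPolynomial.X 0)] : Fin 5 → MvPolynomial (Fin 2) ℚ) ![a - 1, 2 * b - 1, 1 / 2 - b, -a - 2 * b, 1] 2) M.domain ∧ Literature.NumberTheory.Transcendental.KZ.Equivalent M R := by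
  intro a b hb hab hba
  have hbox : ({z : Fin 2 → ℝ | z 0 ∈ Set.Ioo (0:ℝ) 1 ∧ z 1 ∈ Set.Ioo (0:ℝ) 1}) =
      {x | ∀ i, x i ∈ Set.Ioo (0:ℝ) 1} := Set.ext fun z => by simp only [mem_setOf_eq, Fin.forall_fin_two]
  have hA : (0:ℚ) < a + b - 1 / 2 := by linarith
  have hE : (0:ℚ) < a + 1 / 2 - b := by linarith
  have ha : (0:ℚ) < a := by linarith
  have h2b : (0:ℚ) < 2 * b := by positivity
  -- (0) the weighted right box `R`, which exists (Euler's Beta integral)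
  have hintR : IntegrableOn (KZ.mellinIntegrand (![X 0, 4 * (1 - X 0), X 1, 1 - X 1] : Fin 4 → MvPolynomial (Fin 2) ℚ)
      ![a + b - 3 / 2, a - b - 1 / 2, a - 1, 2 * b - 1] 2)
      {z : Fin 2 → ℝ | z 0 ∈ Set.Ioo (0:ℝ) 1 ∧ z 1 ∈ Set.Ioo (0:ℝ) 1} := by
    rw [hbox]
    have h := (KZ.integrableOn_cubeBetaIntegrand ![a + b - 1 / 2, a] ![a + 1 / 2 - b, 2 * b]
      (Fin.forall_fin_two.2 ⟨⟨hA, hE⟩, ⟨ha, h2b⟩⟩)).const_mul ((4:ℝ) ^ ((a:ℝ) - b))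
    refine IntegrableOn.congr_fun h (fun z hz => ?_) (KZ.measurableSet_setOf_forall_apply_mem_Ioo 2)
    rw [mellin_Rw_apply, Rw_pin _ _ (hz 0).1 (hz 0).2 (hz 1).1 (hz 1).2]
    simp only [Fin.prod_univ_two, Matrix.cons_val_zero, Matrix.cons_val_one]
    push_cast
    ring
  have hposR : ∀ z ∈ {z : Fin 2 → ℝ | z 0 ∈ Set.Ioo (0:ℝ) 1 ∧ z 1 ∈ Set.Ioo (0:ℝ) 1}, ∀ k, 0 < aeval z
      ((![X 0, 4 * (1 - X 0), X 1, 1 - X 1] : Fin 4 → MvPolynomial (Fin 2) ℚ) k) := by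
    rintro z ⟨h0, h1⟩ k
    fin_cases k
    · simpa using h0.1
    · simp only [Fin.mk_one, Matrix.cons_val_one, Matrix.cons_val_zero, map_mul, map_sub, map_one, map_ofNat,
        MvPolynomial.aeval_X]
      linarith [h0.2]
    · simpa using h1.1
    · simpa [sub_pos] using h1.2
  let R : KZ.IntegralRep 2 := ⟨{z : Fin 2 → ℝ | z 0 ∈ Set.Ioo (0:ℝ) 1 ∧ z 1 ∈ Set.Ioo (0:ℝ) 1}, _,
    KZ.isSemialgebraic_box2, KZ.isSemialgebraicFunOn_mellinIntegrand KZ.isSemialgebraic_box2 _ _ 2 hposR, hintR⟩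
  -- (1) the chart `ρ` of the box by `Ω'`: the representation `M'` on `Ω'`, which exists
  obtain ⟨ρ, ρ', hρ0, hρ1, hsaρ, hderivρ, hinjρ, himageρ, hdetρ⟩ := exists_chartRho
  have hpullρ : ∀ z ∈ {z : Fin 2 → ℝ | (z 0 ∈ Set.Ioo (0:ℝ) 1 ∧ z 1 ∈ Set.Ioo (0:ℝ) 1) ∧ z 1 * (1 - z 0) < z 0},
      KZ.mellinIntegrand (![X 0, 4 * (1 - X 0), X 1, (1 - X 0) * (X 0 - X 1 * (1 - X 0)) * (1 - X 1 ^ 2),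
          X 1 * (X 0 - X 1 * (1 - X 0)) ^ 2 + X 0 * (1 - X 0) * (1 + X 1) ^ 2,
          X 0 + X 1 ^ 2 * X 0 - 2 * X 1 ^ 3 * (1 - X 0)] : Fin 6 → MvPolynomial (Fin 2) ℚ)
        ![a + b - 3 / 2, a - b + 1 / 2, a - 1, 2 * b - 1, -a - 2 * b, 1] (1 / 2) z =
        R.integrand (ρ z) * |(ρ' z).det| := by
    intro z hz
    rw [hdetρ z hz, mellin_rprime_apply]
    change _ = KZ.mellinIntegrand _ _ _ (ρ z) * _
    rw [mellin_Rw_apply, hρ0, hρ1]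
    exact (rho_pullback _ _ hz.1.1.1 hz.1.1.2 hz.1.2.1 hz.1.2.2 hz.2).symm
  have hposM' : ∀ z ∈ {z : Fin 2 → ℝ | (z 0 ∈ Set.Ioo (0:ℝ) 1 ∧ z 1 ∈ Set.Ioo (0:ℝ) 1) ∧ z 1 * (1 - z 0) < z 0},
      ∀ k, 0 < aeval z ((![X 0, 4 * (1 - X 0), X 1, (1 - X 0) * (X 0 - X 1 * (1 - X 0)) * (1 - X 1 ^ 2),
        X 1 * (X 0 - X 1 * (1 - X 0)) ^ 2 + X 0 * (1 - X 0) * (1 + X 1) ^ 2,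
        X 0 + X 1 ^ 2 * X 0 - 2 * X 1 ^ 3 * (1 - X 0)] : Fin 6 → MvPolynomial (Fin 2) ℚ) k) := by
    rintro z ⟨⟨h0, h1⟩, hc⟩ k
    have h1x : 0 < 1 - z 0 := sub_pos.2 h0.2
    have hu : 0 < z 0 - z 1 * (1 - z 0) := sub_pos.2 hc
    have hm2 : 0 < 1 - z 1 ^ 2 := by nlinarith [h1.1, h1.2]
    fin_cases k
    · simpa using h0.1
    · simp only [Fin.mk_one, Matrix.cons_val_one, Matrix.cons_val_zero, map_mul, map_sub, map_one, map_ofNat,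
        MvPolynomial.aeval_X]
      linarith
    · simpa using h1.1
    · simp only [Fin.reduceFinMk, Matrix.cons_val, map_mul, map_sub, map_pow, map_one, MvPolynomial.aeval_X]
      positivity
    · simp only [Fin.reduceFinMk, Matrix.cons_val, map_add, map_mul, map_sub, map_pow, map_one,
        MvPolynomial.aeval_X]
      exact denomR_pos h0.1 h0.2 h1.1.le
    · simp only [Fin.reduceFinMk, Matrix.cons_val, map_add, map_sub, map_mul, map_pow, map_one, map_ofNat,
        MvPolynomial.aeval_X]
      have e1 : 2 * z 1 ^ 3 * (1 - z 0) < 2 * z 1 ^ 2 * z 0 := by nlinarith [pow_pos h1.1 2]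
      have e2 : 0 < z 0 * (1 - z 1 ^ 2) := mul_pos h0.1 hm2
      nlinarith
  have hintM' : IntegrableOn (KZ.mellinIntegrand (![X 0, 4 * (1 - X 0), X 1,
      (1 - X 0) * (X 0 - X 1 * (1 - X 0)) * (1 - X 1 ^ 2), X 1 * (X 0 - X 1 * (1 - X 0)) ^ 2 + X 0 * (1 - X 0) * (1 + X 1) ^ 2,
      X 0 + X 1 ^ 2 * X 0 - 2 * X 1 ^ 3 * (1 - X 0)] : Fin 6 → MvPolynomial (Fin 2) ℚ)
        ![a + b - 3 / 2, a - b + 1 / 2, a - 1, 2 * b - 1, -a - 2 * b, 1] (1 / 2))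
      {z : Fin 2 → ℝ | (z 0 ∈ Set.Ioo (0:ℝ) 1 ∧ z 1 ∈ Set.Ioo (0:ℝ) 1) ∧ z 1 * (1 - z 0) < z 0} := by
    have key := (integrableOn_image_iff_integrableOn_abs_det_fderiv_smul volume
      isSemialgebraic_regionOmega'.measurableSet_holds (fun z hz => (hderivρ z hz).hasFDerivWithinAt) hinjρ
      R.integrand).1 (by rw [himageρ]; exact R.integrableOn)
    refine key.congr_fun (fun z hz => ?_) isSemialgebraic_regionOmega'.measurableSet_holds
    change |(ρ' z).det| • R.integrand (ρ z) = _
    rw [hpullρ z hz, smul_eq_mul, mul_comm]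
  let M' : KZ.IntegralRep 2 := ⟨{z : Fin 2 → ℝ | (z 0 ∈ Set.Ioo (0:ℝ) 1 ∧ z 1 ∈ Set.Ioo (0:ℝ) 1) ∧
      z 1 * (1 - z 0) < z 0}, _, isSemialgebraic_regionOmega',
    KZ.isSemialgebraicFunOn_mellinIntegrand isSemialgebraic_regionOmega' _ _ (1 / 2) hposM', hintM'⟩
  have relρ : of M' - of R ∈ relations :=
    changeOfVariablesRel_subset_relations ⟨2, M', R, ρ, ρ', hsaρ, fun z hz => (hderivρ z hz).hasFDerivWithinAt,
      hinjρ, himageρ.symm, fun z hz => hpullρ z hz, rfl⟩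
  -- (2) the chart `κ` of `Ω` by `Ω'`: the representation `M` on `Ω`, which exists
  obtain ⟨κ, κ', hκ0, hκ1, hsaκ, hderivκ, hinjκ, himageκ, hdetκ⟩ := exists_chartKappa
  have hpullκ : ∀ z ∈ {z : Fin 2 → ℝ | (z 0 ∈ Set.Ioo (0:ℝ) 1 ∧ z 1 ∈ Set.Ioo (0:ℝ) 1) ∧ z 1 * (1 - z 0) < z 0},
      M'.integrand z = KZ.mellinIntegrand (![4 * X 1 * X 0, 4 * X 0 * (X 1 - X 0) * (1 - X 1 ^ 2), 64 * X 0,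
        X 1 * (X 1 - X 0) ^ 2 + X 0 * (1 + X 1) ^ 2, X 0 * (1 + X 1 ^ 2 - 2 * X 1 * X 0)] :
          Fin 5 → MvPolynomial (Fin 2) ℚ) ![a - 1, 2 * b - 1, 1 / 2 - b, -a - 2 * b, 1] 2 (κ z) *
        |(κ' z).det| := by
    intro z hz
    rw [hdetκ z hz, mellin_r_apply, hκ0, hκ1]
    change KZ.mellinIntegrand _ _ _ z = _
    rw [mellin_rprime_apply]
    exact (kappa_pullback _ _ hz.1.1.1 hz.1.1.2 hz.1.2.1 hz.1.2.2 hz.2).symm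
  have hposM : ∀ z ∈ {z : Fin 2 → ℝ | 0 < z 0 ∧ z 0 < z 1 ∧ z 1 < 1}, ∀ k, 0 < aeval z
      ((![4 * X 1 * X 0, 4 * X 0 * (X 1 - X 0) * (1 - X 1 ^ 2), 64 * X 0,
          X 1 * (X 1 - X 0) ^ 2 + X 0 * (1 + X 1) ^ 2, X 0 * (1 + X 1 ^ 2 - 2 * X 1 * X 0)] :
            Fin 5 → MvPolynomial (Fin 2) ℚ) k) := by
    rintro z ⟨h0, h01, h1⟩ k
    have hm : 0 < z 1 := lt_trans h0 h01
    have hm2 : 0 < 1 - z 1 ^ 2 := by nlinarith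
    fin_cases k
    · simp only [Fin.zero_eta, Matrix.cons_val_zero, map_mul, map_ofNat, MvPolynomial.aeval_X]
      positivity
    · simp only [Fin.mk_one, Matrix.cons_val_one, Matrix.cons_val_zero, map_mul, map_sub, map_pow, map_one,
        map_ofNat, MvPolynomial.aeval_X]
      exact mul_pos (mul_pos (by positivity) (sub_pos.2 h01)) hm2
    · simp only [Fin.reduceFinMk, Matrix.cons_val, map_mul, map_ofNat, MvPolynomial.aeval_X]
      positivity
    · simp only [Fin.reduceFinMk, Matrix.cons_val, map_add, map_mul, map_sub, map_pow, map_one,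
        MvPolynomial.aeval_X]
      exact denomL_pos h0.le hm h1.le
    · simp only [Fin.reduceFinMk, Matrix.cons_val, map_mul, map_add, map_sub, map_pow, map_one, map_ofNat,
        MvPolynomial.aeval_X]
      have : 0 < 1 + z 1 ^ 2 - 2 * z 1 * z 0 := by nlinarith
      positivity
  have hintM : IntegrableOn (KZ.mellinIntegrand (![4 * X 1 * X 0, 4 * X 0 * (X 1 - X 0) * (1 - X 1 ^ 2), 64 * X 0,
      X 1 * (X 1 - X 0) ^ 2 + X 0 * (1 + X 1) ^ 2, X 0 * (1 + X 1 ^ 2 - 2 * X 1 * X 0)] :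
        Fin 5 → MvPolynomial (Fin 2) ℚ) ![a - 1, 2 * b - 1, 1 / 2 - b, -a - 2 * b, 1] 2)
      {z : Fin 2 → ℝ | 0 < z 0 ∧ z 0 < z 1 ∧ z 1 < 1} := by
    rw [← himageκ, integrableOn_image_iff_integrableOn_abs_det_fderiv_smul volume
      isSemialgebraic_regionOmega'.measurableSet_holds (fun z hz => (hderivκ z hz).hasFDerivWithinAt) hinjκ]
    refine M'.integrableOn.congr_fun (fun z hz => ?_) isSemialgebraic_regionOmega'.measurableSet_holds
    rw [hpullκ z hz, smul_eq_mul, mul_comm]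
  let M : KZ.IntegralRep 2 := ⟨{z : Fin 2 → ℝ | 0 < z 0 ∧ z 0 < z 1 ∧ z 1 < 1}, _,
    QuadStep.isSemialgebraic_wedge, KZ.isSemialgebraicFunOn_mellinIntegrand QuadStep.isSemialgebraic_wedge _ _ 2 hposM,
    hintM⟩
  have relκ : of M' - of M ∈ relations :=
    changeOfVariablesRel_subset_relations ⟨2, M', M, κ, κ', hsaκ, fun z hz => (hderivκ z hz).hasFDerivWithinAt,
      hinjκ, himageκ.symm, fun z hz => hpullκ z hz, rfl⟩
  refine ⟨R, M, hbox, fun z hz => ?_, rfl, fun z _ => rfl, ?_⟩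
  · change KZ.mellinIntegrand _ _ _ z = _
    rw [mellin_Rw_apply]
    exact Rw_pin _ _ hz.1.1 hz.1.2 hz.2.1 hz.2.2
  · have e : of M - of R = (of M' - of R) - (of M' - of M) := by abel
    show of M - of R ∈ relations
    rw [e]
    exact relations.sub_mem relρ relκ

/-! ## The right chain: the branch exchange -/

/-- **The right chain of the twin-duplication move** (branch exchange): a representation `L` pinned on the
parameter triangle `Ω` with the left integrand `ℓ = 2·pre·2m(m²-t²)` is equivalent to a representation pinned on
the open box with the weighted right integrand `4^{a-b}x^{a+b-3/2}(1-x)^{a-b-½}y^{a-1}(1-y)^{2b-1}`, WHICH EXISTS: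
discard the null curve `c = 0` (`c = 2m³ - tm² - t`) and split `Ω` into its two laps (rule 1a), split
`ℓ = r + 2·pre·c` resp. `r = ℓ + 2·pre·(-c)` on the laps (rule 1b), cancel the two ghost terms through the ghost
chart `(t,m) ↦ (t, 4mt/D̂)` onto their common image (rule 2 twice), reassemble `[Ω, r]` (rule 1a), and pass to
the box by `right_box_chain`. [cite: KontsevichZagier2001, §1.2 rule (2)] -/
theorem twin_right_chain : ∀ (a b : ℚ), 0 < b → 1 / 2 < a + b → b < a + 1 / 2 → ∀ (L : Literature.NumberTheory.Transcendental.KZ.IntegralRep 2), L.domain = {z : Fin 2 → ℝ | 0 < z 0 ∧ z 0 < z 1 ∧ z 1 < 1} → Set.EqOn L.integrand (Literature.NumberTheory.Transcendental.KZ.mellinIntegrand (![4 * MvPolynomial.X 1 * MvPolynomial.X 0, 4 * MvPolynomial.X 0 * (MvPolynomial.X 1 - MvPolynomial.X 0) * (1 - MvPolynomial.X 1 ^ 2), 64 * MvPolynomial.X 0, MvPolynomial.X 1 * (MvPolynomial.X 1 - MvPolynomial.X 0) ^ 2 + MvPolynomial.X 0 * (1 + MvPolynomial.X 1) ^ 2,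 2 * MvPolynomial.X 1 * (MvPolynomial.X 1 ^ 2 - MvPolynomial.X 0 ^ 2)] : Fin 5 → MvPolynomial (Fin 2) ℚ) ![a - 1, 2 * b - 1, 1 / 2 - b, -a - 2 * b, 1] 2) L.domain → ∃ R : Literature.NumberTheory.Transcendental.KZ.IntegralRep 2, R.domain = {x | ∀ i, x i ∈ Set.Ioo (0:ℝ) 1} ∧ Set.EqOn R.integrand (fun z => (4:ℝ) ^ ((a:ℝ) - b) * (z 0) ^ ((a:ℝ) + b - 1 / 2 - 1) * (1 - z 0) ^ ((a:ℝ) + 1 / 2 - b - 1) * (z 1) ^ ((a:ℝ) - 1) * (1 - z 1) ^ (2 * (b:ℝ) - 1)) R.domain ∧ Literature.NumberTheory.Transcendental.KZ.Equivalent L R := by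
  intro a b hb hab hba L hLd hLi
  -- the right box `R` and the right representation `M = [Ω, r]`
  obtain ⟨R, M, hRd, hRi, hMd, hMi, eMR⟩ := right_box_chain a b hb hab hba
  have hposΩ : ∀ z ∈ {z : Fin 2 → ℝ | 0 < z 0 ∧ z 0 < z 1 ∧ z 1 < 1}, ∀ k : Fin 4, 0 < aeval z
      ((![4 * X 1 * X 0, 4 * X 0 * (X 1 - X 0) * (1 - X 1 ^ 2), 64 * X 0,
          X 1 * (X 1 - X 0) ^ 2 + X 0 * (1 + X 1) ^ 2] : Fin 4 → MvPolynomial (Fin 2) ℚ) k) := by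
    rintro z ⟨h0, h01, h1⟩ k
    have hm : 0 < z 1 := lt_trans h0 h01
    have hm2 : 0 < 1 - z 1 ^ 2 := by nlinarith
    fin_cases k
    · simp only [Fin.zero_eta, Matrix.cons_val_zero, map_mul, map_ofNat, MvPolynomial.aeval_X]
      positivity
    · simp only [Fin.mk_one, Matrix.cons_val_one, Matrix.cons_val_zero, map_mul, map_sub, map_pow, map_one,
        map_ofNat, MvPolynomial.aeval_X]
      exact mul_pos (mul_pos (by positivity) (sub_pos.2 h01)) hm2
    · simp only [Fin.reduceFinMk, Matrix.cons_val, map_mul, map_ofNat, MvPolynomial.aeval_X]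
      positivity
    · simp only [Fin.reduceFinMk, Matrix.cons_val, map_add, map_mul, map_sub, map_pow, map_one,
        MvPolynomial.aeval_X]
      exact denomL_pos h0.le hm h1.le
  -- (3) the two laps and the null curve `c = 0`
  set Pp : Set (Fin 2 → ℝ) := {z | (0 < z 0 ∧ z 0 < z 1 ∧ z 1 < 1) ∧ 0 < 2 * z 1 ^ 3 - z 0 * z 1 ^ 2 - z 0} with hPp
  set Pm : Set (Fin 2 → ℝ) := {z | (0 < z 0 ∧ z 0 < z 1 ∧ z 1 < 1) ∧ 2 * z 1 ^ 3 - z 0 * z 1 ^ 2 - z 0 < 0} with hPm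
  have hPps : IsSemialgebraic ℚ Pp := isSemialgebraic_lapPlus
  have hPms : IsSemialgebraic ℚ Pm := isSemialgebraic_lapMinus
  have hPpL : Pp ⊆ L.domain := fun z hz => by rw [hLd]; exact hz.1
  have hPmL : Pm ⊆ L.domain := fun z hz => by rw [hLd]; exact hz.1
  have hPpM : Pp ⊆ M.domain := fun z hz => by rw [hMd]; exact hz.1
  have hPmM : Pm ⊆ M.domain := fun z hz => by rw [hMd]; exact hz.1
  have hdisj : Pp ∩ Pm = ∅ := Set.ext fun z => by
    simp only [hPp, hPm, mem_inter_iff, mem_setOf_eq, mem_empty_iff_false, iff_false]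
    exact fun h => by linarith [h.1.2, h.2.2]
  have hnull : volume ({z : Fin 2 → ℝ | 0 < z 0 ∧ z 0 < z 1 ∧ z 1 < 1} \ (Pp ∪ Pm)) = 0 := by
    refine measure_mono_null ?_ (volume_setOf_aeval_eq_zero
      (2 * X 1 ^ 3 - X 0 * X 1 ^ 2 - X 0 : MvPolynomial (Fin 2) ℚ) ?_)
    · rintro z ⟨hz, hzn⟩
      simp only [hPp, hPm, mem_union, mem_setOf_eq, not_or] at hzn
      simp only [mem_setOf_eq, map_sub, map_mul, map_pow, map_ofNat, MvPolynomial.aeval_X]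
      rcases lt_trichotomy (2 * z 1 ^ 3 - z 0 * z 1 ^ 2 - z 0) 0 with h | h | h
      · exact absurd ⟨hz, h⟩ hzn.2
      · exact h
      · exact absurd ⟨hz, h⟩ hzn.1
    · intro h0
      have h1 : aeval (![0, 1] : Fin 2 → ℝ) (2 * X 1 ^ 3 - X 0 * X 1 ^ 2 - X 0 : MvPolynomial (Fin 2) ℚ) = 0 := by
        rw [MvPolynomial.aeval_def, ← MvPolynomial.eval_map, h0, map_zero]
      simp only [map_sub, map_mul, map_pow, map_ofNat, MvPolynomial.aeval_X, Matrix.cons_val_zero,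
        Matrix.cons_val_one] at h1
      norm_num at h1
  -- (1a) discard the null curve and split `L` and `M` along the laps
  have hLd' : Pp ∪ Pm ⊆ L.domain := union_subset hPpL hPmL
  have hMd' : Pp ∪ Pm ⊆ M.domain := union_subset hPpM hPmM
  set L₁ : KZ.IntegralRep 2 := L.restrict (Pp ∪ Pm) (hPps.union hPms) hLd' with hL₁
  have rel₁ : of L - of L₁ ∈ relations := L.of_sub_of_restrict_mem_relations _ hLd' (by rw [hLd]; exact hnull)
  set LP : KZ.IntegralRep 2 := L.restrict Pp hPps hPpL with hLP
  set LM : KZ.IntegralRep 2 := L.restrict Pm hPms hPmL with hLM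
  have rel₂ : of L₁ - of LP - of LM ∈ relations :=
    domainAddRel_subset_relations ⟨2, L₁, LP, LM, rfl,
      by rw [KZ.IntegralRep.domain_restrict, KZ.IntegralRep.domain_restrict, hdisj, measure_empty],
      fun _ _ => rfl, fun _ _ => rfl, rfl⟩
  set M₁ : KZ.IntegralRep 2 := M.restrict (Pp ∪ Pm) (hPps.union hPms) hMd' with hM₁
  have rel₃ : of M - of M₁ ∈ relations := M.of_sub_of_restrict_mem_relations _ hMd' (by rw [hMd]; exact hnull)
  set MP : KZ.IntegralRep 2 := M.restrict Pp hPps hPpM with hMP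
  set MM : KZ.IntegralRep 2 := M.restrict Pm hPms hPmM with hMM
  have rel₄ : of M₁ - of MP - of MM ∈ relations :=
    domainAddRel_subset_relations ⟨2, M₁, MP, MM, rfl,
      by rw [KZ.IntegralRep.domain_restrict, KZ.IntegralRep.domain_restrict, hdisj, measure_empty],
      fun _ _ => rfl, fun _ _ => rfl, rfl⟩
  -- (1b) the ghost terms `[Ω₊, 2·pre·c]`, `[Ω₋, -2·pre·c]`, which exist (`= ±(ℓ - r)`)
  have hposGp : ∀ z ∈ Pp, ∀ k, 0 < aeval z
      ((![4 * X 1 * X 0, 4 * X 0 * (X 1 - X 0) * (1 - X 1 ^ 2), 64 * X 0,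
          X 1 * (X 1 - X 0) ^ 2 + X 0 * (1 + X 1) ^ 2, 2 * X 1 ^ 3 - X 0 * X 1 ^ 2 - X 0] :
            Fin 5 → MvPolynomial (Fin 2) ℚ) k) := by
    rintro z ⟨hz, hc⟩ k
    fin_cases k
    · simpa using hposΩ z hz 0
    · simpa using hposΩ z hz 1
    · simpa using hposΩ z hz 2
    · simpa using hposΩ z hz 3
    · simpa using hc
  have hposGm : ∀ z ∈ Pm, ∀ k, 0 < aeval z
      ((![4 * X 1 * X 0, 4 * X 0 * (X 1 - X 0) * (1 - X 1 ^ 2), 64 * X 0,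
          X 1 * (X 1 - X 0) ^ 2 + X 0 * (1 + X 1) ^ 2, -(2 * X 1 ^ 3 - X 0 * X 1 ^ 2 - X 0)] :
            Fin 5 → MvPolynomial (Fin 2) ℚ) k) := by
    rintro z ⟨hz, hc⟩ k
    fin_cases k
    · simpa using hposΩ z hz 0
    · simpa using hposΩ z hz 1
    · simpa using hposΩ z hz 2
    · simpa using hposΩ z hz 3
    · simpa using neg_pos.2 hc
  have hintGp : IntegrableOn (KZ.mellinIntegrand (![4 * X 1 * X 0, 4 * X 0 * (X 1 - X 0) * (1 - X 1 ^ 2), 64 * X 0,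
      X 1 * (X 1 - X 0) ^ 2 + X 0 * (1 + X 1) ^ 2, 2 * X 1 ^ 3 - X 0 * X 1 ^ 2 - X 0] :
        Fin 5 → MvPolynomial (Fin 2) ℚ) ![a - 1, 2 * b - 1, 1 / 2 - b, -a - 2 * b, 1] 2) Pp := by
    refine ((L.integrableOn.mono_set hPpL).sub (M.integrableOn.mono_set hPpM)).congr_fun (fun z hz => ?_)
      hPps.measurableSet_holds
    rw [Pi.sub_apply, hLi (hPpL hz), hMi (hPpM hz), ell_eq_r_add_Gp]
    ring
  have hintGm : IntegrableOn (KZ.mellinIntegrand (![4 * X 1 * X 0, 4 * X 0 * (X 1 - X 0) * (1 - X 1 ^ 2), 64 * X 0,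
      X 1 * (X 1 - X 0) ^ 2 + X 0 * (1 + X 1) ^ 2, -(2 * X 1 ^ 3 - X 0 * X 1 ^ 2 - X 0)] :
        Fin 5 → MvPolynomial (Fin 2) ℚ) ![a - 1, 2 * b - 1, 1 / 2 - b, -a - 2 * b, 1] 2) Pm := by
    refine ((M.integrableOn.mono_set hPmM).sub (L.integrableOn.mono_set hPmL)).congr_fun (fun z hz => ?_)
      hPms.measurableSet_holds
    rw [Pi.sub_apply, hLi (hPmL hz), hMi (hPmM hz), r_eq_ell_add_Gn]
    ring
  let Gp : KZ.IntegralRep 2 := ⟨Pp, _, hPps, KZ.isSemialgebraicFunOn_mellinIntegrand hPps _ _ 2 hposGp, hintGp⟩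
  let Gm : KZ.IntegralRep 2 := ⟨Pm, _, hPms, KZ.isSemialgebraicFunOn_mellinIntegrand hPms _ _ 2 hposGm, hintGm⟩
  have rel₅ : of LP - of MP - of Gp ∈ relations := by
    refine integrandAddRel_subset_relations ⟨2, LP, MP, Gp, rfl, rfl, fun z hz => ?_, rfl⟩
    change L.integrand z = M.integrand z + KZ.mellinIntegrand _ _ _ z
    rw [hLi (hPpL hz), hMi (hPpM hz)]
    exact ell_eq_r_add_Gp a b z
  have rel₆ : of MM - of LM - of Gm ∈ relations := by
    refine integrandAddRel_subset_relations ⟨2, MM, LM, Gm, rfl, rfl, fun z hz => ?_, rfl⟩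
    change M.integrand z = L.integrand z + KZ.mellinIntegrand _ _ _ z
    rw [hLi (hPmL hz), hMi (hPmM hz)]
    exact r_eq_ell_add_Gn a b z
  -- (2) the branch exchange: both ghost terms are the ghost representation on the common image `E`
  obtain ⟨Ψ, Ψ', hΨ0, hΨ1, hsaΨp, hsaΨm, hderivΨ, hinjΨp, hinjΨm, himageΨ, hdetΨ⟩ := exists_chartPi
  have hEs : IsSemialgebraic ℚ (Ψ '' Pp) :=
    IsSemialgebraicMapOn.isSemialgebraic_image_holds hsaΨp subset_rfl hPps
  have hkey : ∀ z ∈ {z : Fin 2 → ℝ | 0 < z 0 ∧ z 0 < z 1 ∧ z 1 < 1},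
      Ψ z 1 * (1 + Ψ z 0) ^ 2 - 4 * Ψ z 0 = 4 * z 0 * (z 1 - z 0) * ((1 - z 1) * (1 + z 1)) /
        (z 1 * (z 1 - z 0) ^ 2 + z 0 * (1 + z 1) ^ 2) := by
    intro z hz
    have hD := (denomL_pos hz.1.le (lt_trans hz.1 hz.2.1) hz.2.2.le).ne'
    rw [hΨ0, hΨ1]
    field_simp
    ring
  have hposE : ∀ y ∈ Ψ '' Pp, ∀ k, 0 < aeval y
      ((![X 1, X 1 * (1 + X 0) ^ 2 - 4 * X 0, 64 * X 0, 2 * X 0] : Fin 4 → MvPolynomial (Fin 2) ℚ) k) := by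
    rintro y ⟨z, ⟨hz, -⟩, rfl⟩ k
    have ht : 0 < Ψ z 0 := by rw [hΨ0]; exact hz.1
    have hm : 0 < z 1 := lt_trans hz.1 hz.2.1
    have hD := denomL_pos hz.1.le hm hz.2.2.le
    have hP : 0 < Ψ z 1 := by rw [hΨ1]; exact div_pos (by have := hz.1; positivity) hD
    fin_cases k
    · simpa using hP
    · simp only [Fin.mk_one, Matrix.cons_val_one, Matrix.cons_val_zero, map_sub, map_mul, map_add, map_pow,
        map_one, map_ofNat, MvPolynomial.aeval_X]
      rw [hkey z hz]
      have h1 : 0 < z 1 - z 0 := sub_pos.2 hz.2.1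
      have h2 : 0 < 1 - z 1 := sub_pos.2 hz.2.2
      exact div_pos (by have := hz.1; positivity) hD
    · simp only [Fin.reduceFinMk, Matrix.cons_val, map_mul, map_ofNat, MvPolynomial.aeval_X]
      positivity
    · simp only [Fin.reduceFinMk, Matrix.cons_val, map_mul, map_ofNat, MvPolynomial.aeval_X]
      positivity
  have hpullΨp : ∀ z ∈ Pp, Gp.integrand z = KZ.mellinIntegrand (![X 1, X 1 * (1 + X 0) ^ 2 - 4 * X 0, 64 * X 0,
      2 * X 0] : Fin 4 → MvPolynomial (Fin 2) ℚ) ![a - 1, 2 * b - 1, 1 / 2 - b, -1] 1 (Ψ z) * |(Ψ' z).det| := by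
    intro z hz
    have hD := denomL_pos hz.1.1.le (lt_trans hz.1.1 hz.1.2.1) hz.1.2.2.le
    have hX : 0 < 4 * z 0 * (2 * z 1 ^ 3 - z 0 * z 1 ^ 2 - z 0) / (z 1 * (z 1 - z 0) ^ 2 + z 0 * (1 + z 1) ^ 2) ^ 2 :=
      div_pos (mul_pos (mul_pos four_pos hz.1.1) hz.2) (pow_pos hD 2)
    rw [hdetΨ z hz.1, abs_neg, abs_of_pos hX]
    change KZ.mellinIntegrand _ _ _ z = _
    rw [mellin_Gp_apply, mellin_E_apply, hΨ0, hΨ1]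
    exact (pi_pullback _ _ hz.1.1 hz.1.2.1 hz.1.2.2 _).symm
  have hpullΨm : ∀ z ∈ Pm, Gm.integrand z = KZ.mellinIntegrand (![X 1, X 1 * (1 + X 0) ^ 2 - 4 * X 0, 64 * X 0,
      2 * X 0] : Fin 4 → MvPolynomial (Fin 2) ℚ) ![a - 1, 2 * b - 1, 1 / 2 - b, -1] 1 (Ψ z) * |(Ψ' z).det| := by
    intro z hz
    have hD := denomL_pos hz.1.1.le (lt_trans hz.1.1 hz.1.2.1) hz.1.2.2.le
    have hX : 0 < -(4 * z 0 * (2 * z 1 ^ 3 - z 0 * z 1 ^ 2 - z 0) / (z 1 * (z 1 - z 0) ^ 2 + z 0 * (1 + z 1) ^ 2) ^ 2) := by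
      rw [neg_pos]
      exact div_neg_of_neg_of_pos (mul_neg_of_pos_of_neg (mul_pos four_pos hz.1.1) hz.2) (pow_pos hD 2)
    rw [hdetΨ z hz.1, abs_of_pos hX]
    have e : -(4 * z 0 * (2 * z 1 ^ 3 - z 0 * z 1 ^ 2 - z 0) / (z 1 * (z 1 - z 0) ^ 2 + z 0 * (1 + z 1) ^ 2) ^ 2) =
        4 * z 0 * (-(2 * z 1 ^ 3 - z 0 * z 1 ^ 2 - z 0)) / (z 1 * (z 1 - z 0) ^ 2 + z 0 * (1 + z 1) ^ 2) ^ 2 := by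
      ring
    rw [e]
    change KZ.mellinIntegrand _ _ _ z = _
    rw [mellin_Gn_apply, mellin_E_apply, hΨ0, hΨ1]
    exact (pi_pullback _ _ hz.1.1 hz.1.2.1 hz.1.2.2 _).symm
  have hintE : IntegrableOn (KZ.mellinIntegrand (![X 1, X 1 * (1 + X 0) ^ 2 - 4 * X 0, 64 * X 0, 2 * X 0] :
      Fin 4 → MvPolynomial (Fin 2) ℚ) ![a - 1, 2 * b - 1, 1 / 2 - b, -1] 1) (Ψ '' Pp) := by
    rw [integrableOn_image_iff_integrableOn_abs_det_fderiv_smul volume hPps.measurableSet_holds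
      (fun z hz => (hderivΨ z hz.1).hasFDerivWithinAt) hinjΨp]
    refine Gp.integrableOn.congr_fun (fun z hz => ?_) hPps.measurableSet_holds
    rw [hpullΨp z hz, smul_eq_mul, mul_comm]
  let Er : KZ.IntegralRep 2 := ⟨Ψ '' Pp, _, hEs, KZ.isSemialgebraicFunOn_mellinIntegrand hEs _ _ 1 hposE, hintE⟩
  have rel₇ : of Gp - of Er ∈ relations :=
    changeOfVariablesRel_subset_relations ⟨2, Gp, Er, Ψ, Ψ', hsaΨp, fun z hz => (hderivΨ z hz.1).hasFDerivWithinAt,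
      hinjΨp, rfl, fun z hz => hpullΨp z hz, rfl⟩
  have rel₈ : of Gm - of Er ∈ relations :=
    changeOfVariablesRel_subset_relations ⟨2, Gm, Er, Ψ, Ψ', hsaΨm, fun z hz => (hderivΨ z hz.1).hasFDerivWithinAt,
      hinjΨm, himageΨ, fun z hz => hpullΨm z hz, rfl⟩
  -- assembling the chain
  refine ⟨R, hRd, hRi, ?_⟩
  have e : of L - of R = (of L - of L₁) + (of L₁ - of LP - of LM) + (of LP - of MP - of Gp)
      - (of MM - of LM - of Gm) + (of Gp - of Er) - (of Gm - of Er) - (of M₁ - of MP - of MM)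
      - (of M - of M₁) + (of M - of R) := by
    abel
  show of L - of R ∈ relations
  rw [e]
  exact relations.add_mem (relations.sub_mem (relations.sub_mem (relations.sub_mem (relations.add_mem
    (relations.sub_mem (relations.add_mem (relations.add_mem rel₁ rel₂) rel₅) rel₆) rel₇) rel₈) rel₄) rel₃) eMR

end TwinDupStep

end Summit.KontsevichZagierPeriods.FermatIsogeny.BetaProductSectorStubs

end
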